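import Summits.NavierStokesRegularity.NavierStokesRegularity.Theorems.FilamentSkeletonRssCoreLinearInvertibilityOddAttenuation

/-!
# Crux `CoreLinearInvertibility` (stmt-NavierStokesRegularity-17973), route `FilamentSkeletonRss`, line `Sketch`:
# high-rotation attenuation of the local operator on CIRCULAR-MEAN-FREE functions (even sector)

The even-sector twin of `stub_oddAttenuation`: for `λ ∈ (0,1)` and every `ε > 0` there is `R₀` such that
for `R ≥ R₀` and every `C²` function `v` of Gaussian class (with gradient and Hessian) whose circle
means vanish, `∫_{−π}^{π} v(r cos θ, r sin θ) dθ = 0` for all `r > 0`,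

  `‖v‖_{X_λ} ≤ ε ‖L_λ v − R v^G·∇v‖_{X_λ}`.

In the odd proof (`…OddAttenuation*.lean`) oddness entered at exactly one place: the zero mean of
`θ ↦ v(r cos θ, r sin θ)` needed by the periodic Wirtinger inequality on circles (tools G). Here that
zero mean is the hypothesis, and it is preserved by the radial ground-state conjugation
`ũ = e^{(1−λ)|x|²/8} v`; everything else (energy, weighted, rotation estimates, the real-variable
endgame) is reused verbatim. This is the attenuation input for the non-radial part of the even sector
(Maekawa, M3AS 19 (2009), Lemma 4.2 (4.12): `lim_{|α|→∞}` of the non-radial blocks), which is fed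
circular-mean-free `w + u_w` by `stub_evenSymmetrizerBounds`.
-/

set_option linter.dupNamespace false

noncomputable section

namespace Summit.NavierStokesRegularity.NavierStokesRegularity.Theorems

open MeasureTheory Filter Topology Set
open Literature.Analysis.FluidPDE
open Summit.AnomalousDissipation.AnomalousDissipation.Theorems.MarginalStabilityChainStretchedVortexRows
open scoped InnerProductSpace Laplacian ContDiff

/-! ### Wirtinger on circles for circular-mean-free functions -/

/-- **Circle-wise Wirtinger under zero circle mean**: for `u ∈ C¹(ℝ²)` and `r` with
`∫_{−π}^{π} u(γ_r) = 0`, `∫_{−π}^{π} u(γ_r)² ≤ ∫_{−π}^{π} (Du(γ_r)[γ_r^⊥])²`, `γ_r(θ) = (r cos θ, r sin θ)`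
(`wirtinger_periodic` with period `2π`; `(u ∘ γ_r)′ = Du[γ_r^⊥]`). [folklore] -/
theorem intervalIntegral_sq_circle_le_of_circMean (u : EuclideanSpace ℝ (Fin 2) → ℝ) (hu : ContDiff ℝ 1 u)
    {r : ℝ} (hmean : ∫ θ in (-Real.pi)..Real.pi, u (circlePt r θ) = 0) :
    ∫ θ in (-Real.pi)..Real.pi, u (circlePt r θ) ^ 2 ≤
      ∫ θ in (-Real.pi)..Real.pi, (fderiv ℝ u (circlePt r θ) (perp (circlePt r θ))) ^ 2 := by
  set g : ℝ → ℝ := fun θ => u (circlePt r θ) with hg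
  have hγ : ContDiff ℝ 1 (fun θ : ℝ => circlePt r θ) := by
    rw [show (fun θ : ℝ => circlePt r θ) = fun θ => (r * Real.cos θ) • EuclideanSpace.single (0 : Fin 2) (1 : ℝ) +
        (r * Real.sin θ) • EuclideanSpace.single (1 : Fin 2) (1 : ℝ) from funext (circlePt_eq_smul_single r)]
    fun_prop
  have hgC : ContDiff ℝ 1 g := hu.comp hγ
  have hgd : ∀ θ, HasDerivAt g (fderiv ℝ u (circlePt r θ) (perp (circlePt r θ))) θ := fun θ =>
    ((hu.differentiable one_ne_zero) _).hasFDerivAt.comp_hasDerivAt θ (hasDerivAt_circlePt r θ)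
  have hderiv : ∀ θ, deriv g θ = fderiv ℝ u (circlePt r θ) (perp (circlePt r θ)) := fun θ => (hgd θ).deriv
  have hper : g (-Real.pi) = g Real.pi := by
    have h : circlePt r (-Real.pi) = circlePt r Real.pi := by
      rw [circlePt_eq_smul_single, circlePt_eq_smul_single, Real.cos_neg, Real.sin_neg, Real.sin_pi, neg_zero]
    simp only [hg, h]
  have hW := wirtinger_periodic hgC (by linarith [Real.pi_pos] : -Real.pi < Real.pi) hper hmean
  have e : ((Real.pi - -Real.pi) / (2 * Real.pi)) ^ 2 = 1 := by
    field_simp; ring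
  rw [e, one_mul] at hW
  simp_rw [hderiv] at hW
  exact hW

/-- **`∫ Ω u² ≤ ∫ Ω (∂_θu)²`** for `u ∈ C¹(ℝ²)` with zero circle means (`r > 0`) and `Ω(∂_θu)² ∈ L¹`
(`Ω = (8π)⁻¹φ(|x|²/4)` radial, continuous, positive: comparison circle by circle); in particular
`Ω u² ∈ L¹`. [folklore] -/
theorem integral_omega_mul_sq_le_of_circMean (u : EuclideanSpace ℝ (Fin 2) → ℝ) (hu : ContDiff ℝ 1 u)
    (hmean : ∀ r : ℝ, 0 < r → ∫ θ in (-Real.pi)..Real.pi, u (circlePt r θ) = 0)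
    (hint : Integrable fun x => (8 * Real.pi)⁻¹ * burgersPhi (‖x‖ ^ 2 / 4) * fderiv ℝ u x (perp x) ^ 2) :
    Integrable (fun x => (8 * Real.pi)⁻¹ * burgersPhi (‖x‖ ^ 2 / 4) * u x ^ 2) ∧
      ∫ x, (8 * Real.pi)⁻¹ * burgersPhi (‖x‖ ^ 2 / 4) * u x ^ 2 ≤
        ∫ x, (8 * Real.pi)⁻¹ * burgersPhi (‖x‖ ^ 2 / 4) * fderiv ℝ u x (perp x) ^ 2 := by
  have hΩc : Continuous fun x : EuclideanSpace ℝ (Fin 2) => (8 * Real.pi)⁻¹ * burgersPhi (‖x‖ ^ 2 / 4) :=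
    (contDiff_omega (n := 0)).continuous
  have hΩ0 : ∀ x : EuclideanSpace ℝ (Fin 2), 0 ≤ (8 * Real.pi)⁻¹ * burgersPhi (‖x‖ ^ 2 / 4) := fun x =>
    (mul_pos (by positivity) (burgersPhi_pos _)).le
  have hθc : Continuous fun x => fderiv ℝ u x (perp x) := (hu.continuous_fderiv one_ne_zero).clm_apply continuous_perp
  refine integral_le_integral_of_forall_circle (hΩc.mul (hu.continuous.pow 2)) (hΩc.mul (hθc.pow 2))
    (fun x => mul_nonneg (hΩ0 x) (sq_nonneg _)) (fun x => mul_nonneg (hΩ0 x) (sq_nonneg _)) hint fun r hr => ?_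
  have hΩr : ∀ θ, (8 * Real.pi)⁻¹ * burgersPhi (‖circlePt r θ‖ ^ 2 / 4) = (8 * Real.pi)⁻¹ * burgersPhi (r ^ 2 / 4) := by
    intro θ; rw [norm_circlePt, sq_abs]
  show ∫ θ in (-Real.pi)..Real.pi, (8 * Real.pi)⁻¹ * burgersPhi (‖circlePt r θ‖ ^ 2 / 4) * u (circlePt r θ) ^ 2 ≤
    ∫ θ in (-Real.pi)..Real.pi, (8 * Real.pi)⁻¹ * burgersPhi (‖circlePt r θ‖ ^ 2 / 4) *
      fderiv ℝ u (circlePt r θ) (perp (circlePt r θ)) ^ 2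
  simp_rw [hΩr]
  rw [intervalIntegral.integral_const_mul, intervalIntegral.integral_const_mul]
  exact mul_le_mul_of_nonneg_left (intervalIntegral_sq_circle_le_of_circMean u hu (hmean r hr))
    (mul_pos (by positivity) (burgersPhi_pos _)).le

/-! ### The two-zone lower bound for `Θ = ∫ Ω (∂_θu)²` -/

section Decay

variable {u : EuclideanSpace ℝ (Fin 2) → ℝ} (hu : ContDiff ℝ 2 u)
  (hB : ∃ (C : ℝ) (N : ℕ), ∀ x, |u x| ≤ C * (1 + ‖x‖) ^ N * Real.exp (-(1 / 8 * ‖x‖ ^ 2)) ∧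
      ‖fderiv ℝ u x‖ ≤ C * (1 + ‖x‖) ^ N * Real.exp (-(1 / 8 * ‖x‖ ^ 2)) ∧
      ‖fderiv ℝ (fderiv ℝ u) x‖ ≤ C * (1 + ‖x‖) ^ N * Real.exp (-(1 / 8 * ‖x‖ ^ 2)))

include hu hB in
/-- **(Θ) The two-zone lower bound** under zero circle means: for `u ∈ C²` of Gaussian decay with
`∫_{−π}^{π} u(γ_r) = 0` (`r > 0`) and every `ρ > 0`, `∫ u² ≤ 2π(4+ρ²) ∫ Ω (∂_θu)² + ρ⁻² ∫|x|²u²`. [folklore] -/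
theorem evenAttenuation_twoZone_estimate
    (hmean : ∀ r : ℝ, 0 < r → ∫ θ in (-Real.pi)..Real.pi, u (circlePt r θ) = 0) {ρ : ℝ} (hρ : 0 < ρ) :
    ∫ x, u x ^ 2 ≤ 2 * Real.pi * (4 + ρ ^ 2) *
        (∫ x, (8 * Real.pi)⁻¹ * burgersPhi (‖x‖ ^ 2 / 4) * fderiv ℝ u x (perp x) ^ 2) +
      (ρ ^ 2)⁻¹ * ∫ x, ‖x‖ ^ 2 * u x ^ 2 := by
  have hU := gaussDecay_self hB
  have hUθ := gaussDecay_fderiv_perp hB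
  have hcθ := continuous_fderiv_perp_of_contDiff_two hu
  have iΘ : Integrable fun x => (8 * Real.pi)⁻¹ * burgersPhi (‖x‖ ^ 2 / 4) * fderiv ℝ u x (perp x) ^ 2 :=
    integrable_of_gaussDecay (by norm_num) ((contDiff_omega (n := 0)).continuous.mul (hcθ.pow 2))
      (gaussDecay_of_le_poly_mul_mul polyBound_omega hUθ hUθ fun x => abs_mul_sq_le _ _)
  obtain ⟨iΩ, hWirt⟩ := integral_omega_mul_sq_le_of_circMean u (hu.of_le one_le_two) hmean iΘ
  have iu2 : Integrable fun x => u x ^ 2 :=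
    integrable_of_gaussDecay (by norm_num) (hu.continuous.pow 2)
      (gaussDecay_of_le_poly_mul_mul (polyBound_const 1) hU hU fun x => abs_sq_le_one_mul _)
  have iX : Integrable fun x => ‖x‖ ^ 2 * u x ^ 2 :=
    integrable_of_gaussDecay (by norm_num) ((continuous_norm.pow 2).mul (hu.continuous.pow 2))
      (gaussDecay_of_le_poly_mul_mul polyBound_norm_sq hU hU fun x => abs_mul_sq_le _ _)
  have i1 : Integrable fun x => 2 * Real.pi * (4 + ρ ^ 2) * ((8 * Real.pi)⁻¹ * burgersPhi (‖x‖ ^ 2 / 4) * u x ^ 2) :=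
    iΩ.const_mul _
  have i2 : Integrable fun x => (ρ ^ 2)⁻¹ * (‖x‖ ^ 2 * u x ^ 2) := iX.const_mul _
  calc ∫ x, u x ^ 2 ≤ ∫ x, 2 * Real.pi * (4 + ρ ^ 2) * ((8 * Real.pi)⁻¹ * burgersPhi (‖x‖ ^ 2 / 4) * u x ^ 2) +
        (ρ ^ 2)⁻¹ * (‖x‖ ^ 2 * u x ^ 2) := integral_mono iu2 (i1.add i2) fun x => sq_le_two_zone_split u hρ x
    _ = 2 * Real.pi * (4 + ρ ^ 2) * (∫ x, (8 * Real.pi)⁻¹ * burgersPhi (‖x‖ ^ 2 / 4) * u x ^ 2) +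
        (ρ ^ 2)⁻¹ * ∫ x, ‖x‖ ^ 2 * u x ^ 2 := by
        rw [integral_add i1 i2, integral_const_mul, integral_const_mul]
    _ ≤ _ := by
        have h2π : 0 ≤ 2 * Real.pi * (4 + ρ ^ 2) := by positivity
        nlinarith [mul_le_mul_of_nonneg_left hWirt h2π]

end Decay

/-- The radial conjugation preserves zero circle means:
`∫ (e^{(1−λ)|·|²/8} v)(γ_r) dθ = e^{(1−λ)r²/8} ∫ v(γ_r) dθ`. [folklore] -/
theorem conj_circMean (v : EuclideanSpace ℝ (Fin 2) → ℝ) (lam r : ℝ) :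
    ∫ θ in (-Real.pi)..Real.pi, Real.exp ((1 - lam) / 8 * ‖circlePt r θ‖ ^ 2) * v (circlePt r θ) =
      Real.exp ((1 - lam) / 8 * r ^ 2) * ∫ θ in (-Real.pi)..Real.pi, v (circlePt r θ) := by
  rw [← intervalIntegral.integral_const_mul]
  refine intervalIntegral.integral_congr fun θ _ => ?_
  simp only [norm_circlePt, sq_abs]

/-! ### The attenuation theorem -/

/-- **High-rotation attenuation of the LOCAL operator on circular-mean-free functions** (even-sector
twin of `stub_oddAttenuation`). For `λ ∈ (0,1)` and every `ε > 0` there is `R₀` such that for `R ≥ R₀`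
and every `C²` function `v` of Gaussian class (with its gradient and Hessian) whose circle means vanish
(`∫_{−π}^{π} v(r cos θ, r sin θ) dθ = 0`, `r > 0`), `‖v‖_{X_λ} ≤ ε ‖L_λ v − R v^G·∇v‖_{X_λ}`. Proof by
ground-state conjugation, the energy / weighted / angular-momentum identities of the odd case and Wirtinger
on circles under zero circle means. [folklore] -/
theorem attenuation_of_circMean_zero :
    ∀ lam ∈ Set.Ioo (0 : ℝ) 1, ∀ ε : ℝ, 0 < ε → ∃ R₀ : ℝ, ∀ R : ℝ, R₀ ≤ R →
    ∀ v : EuclideanSpace ℝ (Fin 2) → ℝ, ContDiff ℝ 2 v →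
    (∀ r : ℝ, 0 < r → ∫ θ in (-Real.pi)..Real.pi, v (circlePt r θ) = 0) →
    (∃ (C : ℝ) (N : ℕ), ∀ x : EuclideanSpace ℝ (Fin 2),
      |v x| ≤ C * (1 + ‖x‖) ^ N * Real.exp (-(‖x‖ ^ 2 / 4)) ∧
      ‖fderiv ℝ v x‖ ≤ C * (1 + ‖x‖) ^ N * Real.exp (-(‖x‖ ^ 2 / 4)) ∧
      ‖fderiv ℝ (fderiv ℝ v) x‖ ≤ C * (1 + ‖x‖) ^ N * Real.exp (-(‖x‖ ^ 2 / 4))) →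
    ∫ x, (gaussWeightLam lam x)⁻¹ * v x ^ 2 ≤
      ε ^ 2 * ∫ x, (gaussWeightLam lam x)⁻¹ * (strainedVorticityOperator lam v x -
        R * ⟪gaussVortexVelocity x, gradient v x⟫_ℝ) ^ 2 := by
  intro lam hlam ε hε
  obtain ⟨hl0, hl1⟩ := hlam
  -- the constants
  set κ : ℝ := (1 - lam) ^ 2 / 16 with hκ
  set δ : ℝ := lam * (1 - lam) / 4 with hδ
  have h1l : 0 < 1 - lam := by linarith
  have hκ0 : 0 < κ := by rw [hκ]; exact div_pos (pow_pos h1l 2) (by norm_num)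
  have hδ0 : 0 ≤ δ := by rw [hδ]; exact div_nonneg (mul_nonneg hl0.le h1l.le) (by norm_num)
  set A : ℝ := κ⁻¹ * (ε⁻¹ + 1 / 2) with hA
  set D : ℝ := (4 * κ * ε ^ 2)⁻¹ + 2 + A / 2 with hD
  set E : ℝ := Real.sqrt D / ε + lam * D + δ * A with hE
  set M : ℝ := 4 * Real.pi * (4 + 2 * A) with hM
  have hA0 : 0 < A := by rw [hA]; positivity
  refine ⟨M * E + 1, fun R hR v hv hmean hvB => ?_⟩
  -- the conjugated function `ũ = p v` and the conjugated operator `f = H̃ũ`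
  set ut : EuclideanSpace ℝ (Fin 2) → ℝ := fun y => Real.exp ((1 - lam) / 8 * ‖y‖ ^ 2) * v y with hut
  have hu : ContDiff ℝ 2 ut := contDiff_conj hv lam
  have humean : ∀ r : ℝ, 0 < r → ∫ θ in (-Real.pi)..Real.pi, ut (circlePt r θ) = 0 := by
    intro r hr
    simp only [hut]
    rw [conj_circMean v lam r, hmean r hr, mul_zero]
  have hB : ∃ (C : ℝ) (N : ℕ), ∀ x, |ut x| ≤ C * (1 + ‖x‖) ^ N * Real.exp (-(1 / 8 * ‖x‖ ^ 2)) ∧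
      ‖fderiv ℝ ut x‖ ≤ C * (1 + ‖x‖) ^ N * Real.exp (-(1 / 8 * ‖x‖ ^ 2)) ∧
      ‖fderiv ℝ (fderiv ℝ ut) x‖ ≤ C * (1 + ‖x‖) ^ N * Real.exp (-(1 / 8 * ‖x‖ ^ 2)) :=
    conj_gaussDecay hv lam hl0.le hl1.le hvB
  set f : EuclideanSpace ℝ (Fin 2) → ℝ := fun x => Δ ut x + lam * x 0 * fderiv ℝ ut x (EuclideanSpace.single 0 1) -
    (κ * ‖x‖ ^ 2 + δ * x 0 ^ 2) * ut x + (1 + lam) / 2 * ut x -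
    R * ((8 * Real.pi)⁻¹ * burgersPhi (‖x‖ ^ 2 / 4) * fderiv ℝ ut x (perp x)) with hfdef
  have hf : ∀ x, f x = Δ ut x + lam * x 0 * fderiv ℝ ut x (EuclideanSpace.single 0 1) -
      (κ * ‖x‖ ^ 2 + δ * x 0 ^ 2) * ut x + (1 + lam) / 2 * ut x -
      R * ((8 * Real.pi)⁻¹ * burgersPhi (‖x‖ ^ 2 / 4) * fderiv ℝ ut x (perp x)) := fun x => rfl
  have hfc : Continuous f := continuous_conjOp hu lam κ δ R
  have hfB : ∃ (C : ℝ) (N : ℕ), ∀ x, |f x| ≤ C * (1 + ‖x‖) ^ N * Real.exp (-(1 / 8 * ‖x‖ ^ 2)) :=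
    gaussDecay_conjOp hu hB lam κ δ R
  -- the four estimates
  have h1 := oddAttenuation_energy_estimate hu hB hf hfc hfB hδ0
  have h2 := oddAttenuation_weighted_estimate hu hB hf hfc hfB hκ0 hl0.le hδ0
  have h3 := oddAttenuation_rotation_estimate hu hB hf hfc hfB hl0.le hδ0
  have hρ : 0 < Real.sqrt (2 * A) := Real.sqrt_pos.2 (by positivity)
  have h4 := evenAttenuation_twoZone_estimate hu hB humean hρ
  rw [Real.sq_sqrt (by positivity)] at h4
  -- nonnegativity of the flat norms
  have hn : 0 ≤ ∫ x, ut x ^ 2 := integral_nonneg fun x => sq_nonneg _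
  have hq : 0 ≤ ∫ x, f x ^ 2 := integral_nonneg fun x => sq_nonneg _
  have hΘ : 0 ≤ ∫ x, (8 * Real.pi)⁻¹ * burgersPhi (‖x‖ ^ 2 / 4) * fderiv ℝ ut x (perp x) ^ 2 :=
    integral_nonneg fun x => mul_nonneg (mul_pos (by positivity) (burgersPhi_pos _)).le (sq_nonneg _)
  -- the endgame
  have key := oddAttenuation_real_algebra hε hκ0 hl0.le hδ0 hA hD hE hM hn hq hΘ h1 h2 h3 h4 hR
  -- back to `X_λ`
  have hc : 0 < 4 * Real.pi / (1 - lam) := div_pos (by positivity) h1l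
  have eL : ∫ x, (gaussWeightLam lam x)⁻¹ * v x ^ 2 = 4 * Real.pi / (1 - lam) * ∫ x, ut x ^ 2 :=
    integral_inv_gaussWeightLam_mul_sq_eq lam v
  have hpf : ∀ x, Real.exp ((1 - lam) / 8 * ‖x‖ ^ 2) *
      (strainedVorticityOperator lam v x - R * ⟪gaussVortexVelocity x, gradient v x⟫_ℝ) = f x := fun x =>
    expWeight_mul_localOp_eq hv lam R x
  have eR : ∫ x, (gaussWeightLam lam x)⁻¹ * (strainedVorticityOperator lam v x -
      R * ⟪gaussVortexVelocity x, gradient v x⟫_ℝ) ^ 2 = 4 * Real.pi / (1 - lam) * ∫ x, f x ^ 2 := by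
    rw [integral_inv_gaussWeightLam_mul_sq_eq lam]
    congr 1
    exact integral_congr_ae (Eventually.of_forall fun x => by simp only [hpf x])
  rw [eL, eR]
  calc 4 * Real.pi / (1 - lam) * ∫ x, ut x ^ 2 ≤ 4 * Real.pi / (1 - lam) * (ε ^ 2 * ∫ x, f x ^ 2) :=
        mul_le_mul_of_nonneg_left key hc.le
    _ = ε ^ 2 * (4 * Real.pi / (1 - lam) * ∫ x, f x ^ 2) := by ring

/-- **Registered stub `stub_evenAttenuation`** of crux stmt-NavierStokesRegularity-17973 (chain B, the
even sector / Maekawa fact): the circular-mean-free attenuation `attenuation_of_circMean_zero`. [folklore] -/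
theorem stub_evenAttenuation :
    ∀ lam ∈ Set.Ioo (0 : ℝ) 1, ∀ ε : ℝ, 0 < ε → ∃ R₀ : ℝ, ∀ R : ℝ, R₀ ≤ R →
    ∀ v : EuclideanSpace ℝ (Fin 2) → ℝ, ContDiff ℝ 2 v →
    (∀ r : ℝ, 0 < r → ∫ θ in (-Real.pi)..Real.pi, v (circlePt r θ) = 0) →
    (∃ (C : ℝ) (N : ℕ), ∀ x : EuclideanSpace ℝ (Fin 2),
      |v x| ≤ C * (1 + ‖x‖) ^ N * Real.exp (-(‖x‖ ^ 2 / 4)) ∧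
      ‖fderiv ℝ v x‖ ≤ C * (1 + ‖x‖) ^ N * Real.exp (-(‖x‖ ^ 2 / 4)) ∧
      ‖fderiv ℝ (fderiv ℝ v) x‖ ≤ C * (1 + ‖x‖) ^ N * Real.exp (-(‖x‖ ^ 2 / 4))) →
    ∫ x, (gaussWeightLam lam x)⁻¹ * v x ^ 2 ≤
      ε ^ 2 * ∫ x, (gaussWeightLam lam x)⁻¹ * (strainedVorticityOperator lam v x -
        R * ⟪gaussVortexVelocity x, gradient v x⟫_ℝ) ^ 2 :=
  attenuation_of_circMean_zero

end Summit.NavierStokesRegularity.NavierStokesRegularity.Theorems
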